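import Summits.Ventures.LatticeQCDFlow.Exactness.IMHModeHolding
import HarnessLib

/-!
# One step of flow-MCMC from ANY state, exactly: downhill moves are target-distributed, uphill moves are
# model-distributed; the exact acceptance profile

HONEST FRAMING: exact (Metropolis-corrected) sampling algorithms for lattice gauge theory;
figures of merit are autocorrelation/cost numbers at stated couplings and volumes; no
continuum-physics claim.

Venture `LatticeQCDFlow` (cell pub-lqcd), topic `Exactness`; FANOUT row 30 (lean-1, GEN-31).  NEW WORK of the
cell, general state space.  `IMHModeRenewal` (this generation) computed the row of the flow-MCMC kernel
`K = indepMH q w` (proposal `q`, weight `w = dπ/dq`, `π = w·q`, NOT necessarily normalised here) AT A MODE of `w`: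
`K(x₀, ·) = π/w(x₀) + (1 − A(x₀))·δ_{x₀}`.  Away from the mode the row is just as explicit once the state space is cut
at the LEVEL `w(x)` of the current state: a proposal `y` with `w(y) ≤ w(x)` ("downhill") is accepted with
probability `w(y)/w(x)`, a proposal with `w(y) > w(x)` ("uphill") is always accepted.  Hence

* §1 **`imhAcceptE_of_le`** / **`imhAcceptE_of_lt`** / **`imhAcceptE_eq_indicator`** — the acceptance density is
  `(w(y)/w(x))·1{w(y) ≤ w(x)} + 1{w(x) < w(y)}`;
* §2 **`indepMH_apply_level`** — FOR EVERY STATE `x` AND MEASURABLE `B`: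
  `K(x, B) = π(B ∩ {w ≤ w(x)})/w(x) + q(B ∩ {w > w(x)}) + (1 − A(x))·1_B(x)`; in particular
  (**`indepMH_apply_of_subset_lower`**) INTO THE SUB-LEVEL SET the chain moves at the TARGET's rate scaled by
  `1/w(x)`: `K(x, B) = π(B)/w(x)` for `B ⊆ {w ≤ w(x)} ∖ {x}`, and (**`indepMH_apply_of_subset_upper`**) INTO THE
  SUPER-LEVEL SET at the MODEL's rate: `K(x, B) = q(B)` for `B ⊆ {w > w(x)}`;
* §3 **`imhAcceptMass_level`** — THE EXACT ACCEPTANCE PROFILE: `A(x) = π{w ≤ w(x)}/w(x) + q{w > w(x)}` (real form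
  **`imhAcceptMass_toReal_level`**); so (**`model_upper_le_imhAcceptMass`**, **`target_lower_le_imhAcceptMass`**)
  `q{w > w(x)} ≤ A(x)` and `π{w ≤ w(x)}/w(x) ≤ A(x)`, next to the tree's ceiling `A(x) ≤ π(Ω)/w(x)`
  (`IMHKernel.imhAcceptMass_le`); at a mode `{w > w(x₀)} = ∅` and §2–§3 are `IMHModeRenewal.indepMH_mode_apply`.

Reading (for `Scaling/AutoregressiveGauge…`): the exact one-plaquette heat bath at configuration `U` accepts with
probability EXACTLY `(Z/(c^{#B}F_R(U)))·π{F_R ≤ F_R(U)} + q{F_R > F_R(U)}` — the target mass of the configurations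
at most as ordered (on the uncovered plaquettes) as `U`, at the importance ratio of `U`, plus the model mass of the
more ordered ones; GEN-28's squeeze `Z/(c^{#B}M^k) ≤ A(U) ≤ Z/(c^{#B}F_R(U))` is its two one-term truncations.
NOT CLAIMED: multi-step laws from a non-modal start (the level changes along the path).

No `sorry`, no new definitions, nothing cited as a fact.
-/

noncomputable section

namespace Summit.Ventures.LatticeQCDFlow.Exactness

open MeasureTheory ProbabilityTheory Function
open scoped ENNReal

variable {Ω : Type*} [MeasurableSpace Ω]
variable {q : Measure Ω} [IsProbabilityMeasure q] {w : Ω → ℝ}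

/-! ## §1 The acceptance density cut at the level of the current state -/

omit [MeasurableSpace Ω] [IsProbabilityMeasure q] in
/-- Downhill: for `w(y) ≤ w(x)` the acceptance density is `w(y)/w(x)`. [ours] -/
theorem imhAcceptE_of_le (hw0 : ∀ y, 0 < w y) {x y : Ω} (hy : w y ≤ w x) :
    imhAcceptE w x y = ENNReal.ofReal (w x)⁻¹ * ENNReal.ofReal (w y) := by
  unfold imhAcceptE imhAccept
  rw [min_eq_right ((div_le_one (hw0 x)).2 hy), ← ENNReal.ofReal_mul (inv_nonneg.mpr (hw0 x).le),
    div_eq_inv_mul]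

omit [MeasurableSpace Ω] [IsProbabilityMeasure q] in
/-- Uphill: for `w(x) < w(y)` the proposal is always accepted. [ours] -/
theorem imhAcceptE_of_lt (hw0 : ∀ y, 0 < w y) {x y : Ω} (hy : w x < w y) : imhAcceptE w x y = 1 := by
  unfold imhAcceptE imhAccept
  rw [min_eq_left ((one_lt_div (hw0 x)).2 hy).le, ENNReal.ofReal_one]

omit [MeasurableSpace Ω] [IsProbabilityMeasure q] in
/-- **The acceptance density is `(w(y)/w(x))·1{w(y) ≤ w(x)} + 1{w(x) < w(y)}`.** [ours] -/
theorem imhAcceptE_eq_indicator (hw0 : ∀ y, 0 < w y) (x y : Ω) :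
    imhAcceptE w x y = {y | w y ≤ w x}.indicator (fun y => ENNReal.ofReal (w x)⁻¹ * ENNReal.ofReal (w y)) y +
      {y | w x < w y}.indicator 1 y := by
  by_cases hy : w y ≤ w x
  · rw [Set.indicator_of_mem (show y ∈ {y | w y ≤ w x} from hy),
      Set.indicator_of_notMem (show y ∉ {y | w x < w y} from fun h => not_lt.2 hy h), add_zero,
      imhAcceptE_of_le hw0 hy]
  · rw [Set.indicator_of_notMem (show y ∉ {y | w y ≤ w x} from hy),
      Set.indicator_of_mem (show y ∈ {y | w x < w y} from not_le.1 hy), zero_add, Pi.one_apply,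
      imhAcceptE_of_lt hw0 (not_le.1 hy)]

/-- The sub-level set `{w ≤ w(x)}` is measurable. [ours, bookkeeping] -/
theorem measurableSet_level_le (hw : Measurable w) (x : Ω) : MeasurableSet {y | w y ≤ w x} :=
  hw measurableSet_Iic

/-- The super-level set `{w > w(x)}` is measurable. [ours, bookkeeping] -/
theorem measurableSet_level_lt (hw : Measurable w) (x : Ω) : MeasurableSet {y | w x < w y} :=
  hw measurableSet_Ioi

omit [IsProbabilityMeasure q] in
/-- The proposal part of the row, cut at the level: `∫_B a(x, y) q(dy) = π(B ∩ {w ≤ w(x)})/w(x) + q(B ∩ {w > w(x)})`.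
[ours] -/
theorem setLIntegral_imhAcceptE_level (hw : Measurable w) (hw0 : ∀ y, 0 < w y) (x : Ω) {B : Set Ω}
    (hB : MeasurableSet B) :
    ∫⁻ y in B, imhAcceptE w x y ∂q =
      ENNReal.ofReal (w x)⁻¹ * (q.withDensity fun y => ENNReal.ofReal (w y)) (B ∩ {y | w y ≤ w x}) +
        q (B ∩ {y | w x < w y}) := by
  have hS := measurableSet_level_le hw x
  have hT := measurableSet_level_lt hw x
  have hg : Measurable fun y => ENNReal.ofReal (w x)⁻¹ * ENNReal.ofReal (w y) :=
    measurable_const.mul hw.ennreal_ofReal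
  simp_rw [imhAcceptE_eq_indicator hw0 x]
  rw [lintegral_add_left (hg.indicator hS), lintegral_indicator hS, lintegral_indicator hT,
    Measure.restrict_restrict hS, Measure.restrict_restrict hT]
  simp only [Pi.one_apply]
  rw [setLIntegral_one, lintegral_const_mul _ hw.ennreal_ofReal, withDensity_apply _ (hB.inter hS),
    Set.inter_comm B, Set.inter_comm B]

/-! ## §2 The row of the kernel from every state -/

/-- **ONE STEP FROM ANY STATE, EXACTLY**: `K(x, B) = π(B ∩ {w ≤ w(x)})/w(x) + q(B ∩ {w > w(x)}) + (1 − A(x))·1_B(x)`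
for every measurable `B`. [ours] -/
theorem indepMH_apply_level (hw : Measurable w) (hw0 : ∀ y, 0 < w y) (x : Ω) {B : Set Ω} (hB : MeasurableSet B) :
    indepMH q w x B =
      ENNReal.ofReal (w x)⁻¹ * (q.withDensity fun y => ENNReal.ofReal (w y)) (B ∩ {y | w y ≤ w x}) +
        q (B ∩ {y | w x < w y}) + (1 - imhAcceptMass q w x) * B.indicator 1 x := by
  rw [indepMH_apply hw x hB, setLIntegral_imhAcceptE_level hw hw0 x hB]

/-- **INTO THE SUB-LEVEL SET THE CHAIN MOVES AT THE TARGET'S RATE**: for measurable `B ⊆ {w ≤ w(x)}` not containing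
`x`, `K(x, B) = π(B)/w(x)`. [ours] -/
theorem indepMH_apply_of_subset_lower (hw : Measurable w) (hw0 : ∀ y, 0 < w y) {x : Ω} {B : Set Ω}
    (hB : MeasurableSet B) (hsub : B ⊆ {y | w y ≤ w x}) (hx : x ∉ B) :
    indepMH q w x B = ENNReal.ofReal (w x)⁻¹ * (q.withDensity fun y => ENNReal.ofReal (w y)) B := by
  have h1 : B ∩ {y | w y ≤ w x} = B := Set.inter_eq_left.2 hsub
  have h2 : B ∩ {y | w x < w y} = ∅ := by
    ext y
    simp only [Set.mem_inter_iff, Set.mem_setOf_eq, Set.mem_empty_iff_false, iff_false, not_and, not_lt]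
    exact fun hy => hsub hy
  rw [indepMH_apply_level hw hw0 x hB, h1, h2, measure_empty, add_zero, Set.indicator_of_notMem hx, mul_zero,
    add_zero]

/-- **INTO THE SUPER-LEVEL SET THE CHAIN MOVES AT THE MODEL'S RATE**: for measurable `B ⊆ {w > w(x)}`,
`K(x, B) = q(B)` — uphill proposals are always accepted. [ours] -/
theorem indepMH_apply_of_subset_upper (hw : Measurable w) (hw0 : ∀ y, 0 < w y) {x : Ω} {B : Set Ω}
    (hB : MeasurableSet B) (hsub : B ⊆ {y | w x < w y}) : indepMH q w x B = q B := by
  have hx : x ∉ B := fun h => lt_irrefl (w x) (hsub h)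
  have h1 : B ∩ {y | w y ≤ w x} = ∅ := by
    ext y
    simp only [Set.mem_inter_iff, Set.mem_setOf_eq, Set.mem_empty_iff_false, iff_false, not_and, not_le]
    exact fun hy => hsub hy
  have h2 : B ∩ {y | w x < w y} = B := Set.inter_eq_left.2 hsub
  rw [indepMH_apply_level hw hw0 x hB, h1, h2, measure_empty, mul_zero, zero_add, Set.indicator_of_notMem hx,
    mul_zero, add_zero]

/-! ## §3 The exact acceptance profile -/

omit [IsProbabilityMeasure q] in
/-- **THE EXACT ACCEPTANCE PROFILE**: `A(x) = π{w ≤ w(x)}/w(x) + q{w > w(x)}`. [ours] -/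
theorem imhAcceptMass_level (hw : Measurable w) (hw0 : ∀ y, 0 < w y) (x : Ω) :
    imhAcceptMass q w x =
      ENNReal.ofReal (w x)⁻¹ * (q.withDensity fun y => ENNReal.ofReal (w y)) {y | w y ≤ w x} +
        q {y | w x < w y} := by
  unfold imhAcceptMass
  rw [← Measure.restrict_univ (μ := q), setLIntegral_imhAcceptE_level hw hw0 x MeasurableSet.univ,
    Set.univ_inter, Set.univ_inter, Measure.restrict_univ]

omit [IsProbabilityMeasure q] in
/-- Real form for a finite target: `A(x) = π{w ≤ w(x)}/w(x) + q{w > w(x)}` in `ℝ`. [ours] -/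
theorem imhAcceptMass_toReal_level (hw : Measurable w) (hw0 : ∀ y, 0 < w y) (x : Ω) [IsFiniteMeasure q]
    [IsFiniteMeasure (q.withDensity fun y => ENNReal.ofReal (w y))] :
    (imhAcceptMass q w x).toReal =
      (w x)⁻¹ * (q.withDensity fun y => ENNReal.ofReal (w y)).real {y | w y ≤ w x} + q.real {y | w x < w y} := by
  rw [imhAcceptMass_level hw hw0 x, ENNReal.toReal_add (ENNReal.mul_ne_top ENNReal.ofReal_ne_top (measure_ne_top _ _))
    (measure_ne_top _ _), ENNReal.toReal_mul, ENNReal.toReal_ofReal (inv_nonneg.mpr (hw0 x).le), Measure.real,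
    Measure.real]

omit [IsProbabilityMeasure q] in
/-- **Uphill proposals are always accepted**: `q{w > w(x)} ≤ A(x)`. [ours] -/
theorem model_upper_le_imhAcceptMass (hw : Measurable w) (hw0 : ∀ y, 0 < w y) (x : Ω) :
    q {y | w x < w y} ≤ imhAcceptMass q w x := by
  rw [imhAcceptMass_level hw hw0 x]
  exact le_add_self

omit [IsProbabilityMeasure q] in
/-- **The downhill part of the acceptance**: `π{w ≤ w(x)}/w(x) ≤ A(x)`. [ours] -/
theorem target_lower_le_imhAcceptMass (hw : Measurable w) (hw0 : ∀ y, 0 < w y) (x : Ω) :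
    ENNReal.ofReal (w x)⁻¹ * (q.withDensity fun y => ENNReal.ofReal (w y)) {y | w y ≤ w x} ≤
      imhAcceptMass q w x := by
  rw [imhAcceptMass_level hw hw0 x]
  exact le_self_add

/-- **The holding probability from every atom-free state**: `K(x, {x}) = 1 − π{w ≤ w(x)}/w(x) − q{w > w(x)}` when
`q{x} = 0` (GEN-28 `IMHModeHolding.indepMH_apply_singleton_eq` with the profile substituted). [ours] -/
theorem indepMH_apply_singleton_level [MeasurableSingletonClass Ω] (hw : Measurable w) (hw0 : ∀ y, 0 < w y)
    {x : Ω} (hqx : q {x} = 0) :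
    indepMH q w x {x} =
      1 - (ENNReal.ofReal (w x)⁻¹ * (q.withDensity fun y => ENNReal.ofReal (w y)) {y | w y ≤ w x} +
        q {y | w x < w y}) := by
  rw [indepMH_apply_singleton_eq hw hqx, imhAcceptMass_level hw hw0 x]

end Summit.Ventures.LatticeQCDFlow.Exactness
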